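import Literature.Topology.FourManifolds.SphereProductCohomology
import Literature.AlgebraicTopology.SingularHomology.OnePointCollapse
import Literature.AlgebraicTopology.SingularHomology.CohomologyMayerVietorisExtend
import HarnessLib

/-!
# The Thom collapse of a tube of the diagonal of `Sᵏ × Sᵏ` and its Thom class

Topic `Literature/Topology/FourManifolds` (fact seat of
`Literature.Topology.FourManifolds.HomotopySphere.exists_intersectionForm_equivalent_e8Form`,
Kosinski's `E₈` plumbing, VI.12: the self-intersection `[Σᵢ : Σᵢ] = 2` of a presentation sphere,
VI.(12.4), is read in the local model `S²ᵐ × S²ᵐ ⊃` tube of the diagonal). Sequel of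
`SphereProductCohomology.lean`. For `k ≥ 2` even, `X = Sᵏ × Sᵏ`, `N ⊆ X` an open neighbourhood of
the diagonal `Δ`, `φ : N ≃ₜ Y` any homeomorphic copy (e.g. the interior of a compact tube) and
`Y⁺ = OnePoint Y` its one-point compactification ("Thom space"; for the tube, its closed model):

* `SphereProd.abs_cupPairing_g_add_g` — `|⟨(g₁ + g₂)², [X]⟩| = 2` (Milnor–Stasheff Cor. 11.2:
  `Δ · Δ = χ(Sᵏ)`; from `SphereProductCohomology.lean`);
* `SphereProd.eq_zero_of_map_nhd_diagonal_eq_zero` — a class of `Hᵏ(X; ℤ)` vanishing on `N` and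
  on `X ∖ Δ` is zero (it pairs to zero with `diag₊[S] = y₁ + y₂` and `antidiag₊[S] = y₁ - y₂`);
* `SphereProd.thomCollapse` — the Pontryagin–Thom collapse `c : X → Y⁺` (`φ` on `N`, `∞`
  elsewhere; tree: `OnePoint.collapseCM`); `SphereProd.thomIncl` — `N → Y⁺`;
* `SphereProd.exists_thomClass` — **the Thom class** `ξ ∈ Hᵏ(Y⁺; ℤ)`: `ξ|_N = (g₁ + g₂)|_N` and
  `ξ|_{Y⁺ ∖ Δ} = 0`, glued by Mayer–Vietoris (`singularCohomology.exists_of_map_inclusion_eq`)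
  since `(g₁ + g₂)|_{N ∖ Δ} = 0` (`map_compl_diagonal_g_add_g`);
* `SphereProd.map_thomCollapse_thomClass` — **`c^* ξ = g₁ + g₂`** (Milnor–Stasheff Thm. 11.1 /
  §18: the dual class of `Δ` is the pull-back of the Thom class under the collapse);
  `SphereProd.abs_kroneckerPairing_thomClass_sq` — **`|⟨ξ ⌣ ξ, c₊[X]⟩| = 2`**.

These make the diagonal entries of the Gram matrix of a plumbing computable without relative
cohomology: for any closed (homology) manifold `Ŵ` containing an open copy of `N` with core
sphere `Σ`, the class `c_W^* ξ` is the dual of `Σ` and `⟨(c_W^* ξ)², [Ŵ]⟩ = ⟨ξ², c_{W*}[Ŵ]⟩`,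
to be compared with `⟨ξ², c₊[X]⟩ = ⟨(g₁ + g₂)², [X]⟩ = ±2` (sequel). Everything is proved; no
named facts (D-0026).

## References

* J. Milnor, J. Stasheff, *Characteristic classes* (1974), §11 (Thm. 11.1, Cor. 11.2, Lemma 11.5)
  and §18 (the Thom space, p. 205). [MilnorStasheff1974]
* J. Milnor, *Topology from the Differentiable Viewpoint* (1965), §7 (the Pontryagin collapse).
  [MilnorTDV1965]
* A. Hatcher, *Algebraic Topology* (2002), Example 3.11, §3.1 pp. 198, 203–204. [HatcherAT2002]
* A. Kosinski, *Differential Manifolds* (1993), VI.12, (12.4). [Kosinski1993]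
-/

open scoped Manifold ContDiff Topology
open Set Function CategoryTheory CategoryTheory.Limits

noncomputable section

universe u

namespace Literature.Topology.FourManifolds

open Literature.AlgebraicTopology.SingularHomology

/-- Local notation: `𝔼 n` is the model Euclidean space `EuclideanSpace ℝ (Fin n)`. -/
local notation "𝔼 " n:arg => EuclideanSpace ℝ (Fin n)

/-- Local notation: `𝕊 n` is the unit sphere in `EuclideanSpace ℝ (Fin (n + 1))`. -/
local notation "𝕊 " n:arg => (Metric.sphere (0 : EuclideanSpace ℝ (Fin (n + 1))) 1)

namespace SphereProd

variable {k : ℕ}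



section ThomCollapse

variable {N : Set ((𝕊 k) × (𝕊 k))}

/-- The cup-product square of the dual class of the diagonal: **`|⟨(g₁ + g₂) ⌣ (g₁ + g₂), [Sᵏ × Sᵏ]⟩| = 2`**
for `k ≥ 2` even and every orientation (`gₐ² = 0`, `|⟨g₁ ⌣ g₂, [X]⟩| = 1`, graded commutativity):
the self-intersection number `χ(Sᵏ) = 2` of the diagonal (Milnor–Stasheff Cor. 11.2), in the
tree's cup-product form. [cite: MilnorStasheff1974, §11 Cor. 11.2] [cite: HatcherAT2002, Example 3.11] -/
theorem abs_cupPairing_g_add_g (hk : 2 ≤ k) (hke : Even k) {N : ℕ} (hN : k + k = N)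
    (μ : HomologicalOrientation ℤ ((𝕊 k) × (𝕊 k)) N) :
    |cupPairing μ hN (g hk 0 + g hk 1) (g hk 0 + g hk 1)| = 2 := by
  subst hN
  have h01 := abs_cupPairing_g hk μ
  have h10 : cupPairing μ rfl (g hk 1) (g hk 0) = cupPairing μ rfl (g hk 0) (g hk 1) := by
    rw [cupPairing_apply, cupProduct_gradedComm_holds ℤ _ rfl rfl (g hk 1) (g hk 0),
      (kroneckerPairing ℤ ℤ ((𝕊 k) × (𝕊 k)) (k + k)).map_smul, LinearMap.smul_apply, smul_eq_mul,
      Even.neg_one_pow (hke.mul_right k), one_mul, ← cupPairing_apply]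
  simp only [map_add, LinearMap.add_apply, cupPairing_g_self hk μ, h10, zero_add, add_zero]
  rw [← two_mul, abs_mul, h01]
  norm_num

/-- The diagonal map `x ↦ (x, x)`. [folklore] -/
def diagX (k : ℕ) : C(𝕊 k, (𝕊 k) × (𝕊 k)) := ⟨fun x => (x, x), by fun_prop⟩

/-- `prₐ ∘ diag = id`. [folklore] -/
theorem pr_comp_diagX (a : Fin 2) : (pr k a).comp (diagX k) = ContinuousMap.id _ := by
  fin_cases a <;> rfl

/-- `⟨gₐ, diag₊[S]⟩ = 1`. [cite: HatcherAT2002, Example 3.11] -/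
theorem kroneckerPairing_g_diag (hk : 2 ≤ k) (a : Fin 2) :
    kroneckerPairing ℤ ℤ ((𝕊 k) × (𝕊 k)) k (g hk a)
      (singularHomology.map ℤ ℤ (diagX k) k (μS hk).fundamentalClass) = 1 := by
  rw [g, kroneckerPairing_map, ← ModuleCat.comp_apply, ← singularHomology.map_comp,
    pr_comp_diagX, singularHomology.map_id, ModuleCat.id_apply, kroneckerPairing_γ]

/-- The antidiagonal as a map into `Sᵏ × Sᵏ`. [folklore] -/
def antidiagX (k : ℕ) : C(𝕊 k, (𝕊 k) × (𝕊 k)) := (subsetIncl ((diagonal k)ᶜ)).comp (antidiag k)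

/-- `⟨g₁, antidiag₊[S]⟩ = 1`. [cite: HatcherAT2002, Example 3.11] -/
theorem kroneckerPairing_g_zero_antidiag (hk : 2 ≤ k) :
    kroneckerPairing ℤ ℤ ((𝕊 k) × (𝕊 k)) k (g hk 0)
      (singularHomology.map ℤ ℤ (antidiagX k) k (μS hk).fundamentalClass) = 1 := by
  have e0 : (pr k 0).comp (antidiagX k) = ContinuousMap.id _ := by ext x : 1; rfl
  rw [g, kroneckerPairing_map, ← ModuleCat.comp_apply, ← singularHomology.map_comp, e0,
    singularHomology.map_id, ModuleCat.id_apply, kroneckerPairing_γ]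

/-- `⟨g₂, antidiag₊[S]⟩ = -1` (`k` even: the antipodal map has degree `-1`). [cite: HatcherAT2002, §2.2 property (g) and Example 3.11] -/
theorem kroneckerPairing_g_one_antidiag (hk : 2 ≤ k) (hke : Even k) :
    kroneckerPairing ℤ ℤ ((𝕊 k) × (𝕊 k)) k (g hk 1)
      (singularHomology.map ℤ ℤ (antidiagX k) k (μS hk).fundamentalClass) = -1 := by
  have e1 : (pr k 1).comp (antidiagX k) = antipode k := by ext x : 1; rfl
  rw [g, kroneckerPairing_map, ← ModuleCat.comp_apply, ← singularHomology.map_comp, e1,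
    ← kroneckerPairing_map, map_antipode_γ hk hke, map_neg, LinearMap.neg_apply, kroneckerPairing_γ]

/-- The coefficients of a class of `Hₖ(Sᵏ × Sᵏ; ℤ)` on the two factors are its Kronecker values
against `g₁`, `g₂`. [cite: HatcherAT2002, Example 3.11] -/
theorem eq_sum_kroneckerPairing_smul_y (hk : 2 ≤ k) (z : ↥(singularHomology ℤ ℤ ((𝕊 k) × (𝕊 k)) k)) :
    z = (kroneckerPairing ℤ ℤ _ k (g hk 0) z) • y hk 0 + (kroneckerPairing ℤ ℤ _ k (g hk 1) z) • y hk 1 := by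
  obtain ⟨c, hc⟩ := exists_eq_sum_smul_y hk z
  have h0 : kroneckerPairing ℤ ℤ _ k (g hk 0) z = c 0 := by
    rw [hc, map_add, map_zsmul, map_zsmul, kroneckerPairing_g_y_self,
      kroneckerPairing_g_y_of_ne hk (by decide : (0 : Fin 2) ≠ 1)]
    simp
  have h1 : kroneckerPairing ℤ ℤ _ k (g hk 1) z = c 1 := by
    rw [hc, map_add, map_zsmul, map_zsmul, kroneckerPairing_g_y_self,
      kroneckerPairing_g_y_of_ne hk (by decide : (1 : Fin 2) ≠ 0)]
    simp
  rw [h0, h1]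
  exact hc

/-- **A class of `Hᵏ(Sᵏ × Sᵏ; ℤ)` that vanishes near the diagonal and off the diagonal is zero**
(`k ≥ 2` even): it pairs to zero with `diag₊[S] = y₁ + y₂` (which comes from the neighbourhood)
and with `antidiag₊[S] = y₁ - y₂` (which avoids the diagonal), hence with `y₁` and `y₂`, and
classes are detected by the factors. [cite: HatcherAT2002, Example 3.11 and §3.1 p. 198] -/
theorem eq_zero_of_map_nhd_diagonal_eq_zero (hk : 2 ≤ k) (hke : Even k) (hΔ : diagonal k ⊆ N)
    (a : ↥(singularCohomology ℤ ℤ ((𝕊 k) × (𝕊 k)) k))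
    (hN : singularCohomology.map ℤ ℤ (subsetIncl N) k a = 0)
    (hC : singularCohomology.map ℤ ℤ (subsetIncl ((diagonal k)ᶜ)) k a = 0) : a = 0 := by
  -- pairing with the diagonal (factor through `N`) and the antidiagonal (factor through `Δᶜ`)
  let dN : C(𝕊 k, ↥N) := ⟨fun x => ⟨(x, x), hΔ rfl⟩, by fun_prop⟩
  have hd : (subsetIncl N).comp dN = diagX k := by ext x : 1; rfl
  have h1 : kroneckerPairing ℤ ℤ _ k a (singularHomology.map ℤ ℤ (diagX k) k (μS hk).fundamentalClass) = 0 := by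
    rw [← hd, singularHomology.map_comp, ModuleCat.comp_apply, ← kroneckerPairing_map, hN,
      map_zero, LinearMap.zero_apply]
  have h2 : kroneckerPairing ℤ ℤ _ k a (singularHomology.map ℤ ℤ (antidiagX k) k (μS hk).fundamentalClass) = 0 := by
    rw [antidiagX, singularHomology.map_comp, ModuleCat.comp_apply, ← kroneckerPairing_map, hC,
      map_zero, LinearMap.zero_apply]
  -- `diag₊[S] = y₁ + y₂`, `antidiag₊[S] = y₁ - y₂`
  have ed := eq_sum_kroneckerPairing_smul_y hk (singularHomology.map ℤ ℤ (diagX k) k (μS hk).fundamentalClass)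
  rw [kroneckerPairing_g_diag hk 0, kroneckerPairing_g_diag hk 1, one_zsmul, one_zsmul] at ed
  have ea := eq_sum_kroneckerPairing_smul_y hk (singularHomology.map ℤ ℤ (antidiagX k) k (μS hk).fundamentalClass)
  rw [kroneckerPairing_g_zero_antidiag hk, kroneckerPairing_g_one_antidiag hk hke, one_zsmul, neg_one_zsmul] at ea
  rw [ed, map_add] at h1
  rw [ea, map_add, map_neg] at h2
  -- hence `⟨a, y₁⟩ = ⟨a, y₂⟩ = 0`, so `a = 0`
  apply injective_evalH hk
  funext b
  rw [evalH_apply, map_zero, Pi.zero_apply]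
  fin_cases b
  · change kroneckerPairing ℤ ℤ _ k a (y hk 0) = 0
    linarith
  · change kroneckerPairing ℤ ℤ _ k a (y hk 1) = 0
    linarith

variable (hNo : IsOpen N) {Y : Type} [TopologicalSpace Y] (φ : ↥N ≃ₜ Y)

/-- **The Thom collapse** `Sᵏ × Sᵏ → Y⁺` of an open neighbourhood `N ≅ Y` of the diagonal: `φ` on
`N`, the point at infinity elsewhere (Pontryagin–Thom; tree: `OnePoint.collapseCM`). The target
`Y` is any homeomorphic copy of `N` (e.g. the interior of a compact tube, whose one-point
compactification is the tube's closed model). [cite: MilnorStasheff1974, §18 (the Thom space; p. 205)] [cite: MilnorTDV1965, §7] -/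
def thomCollapse (hNo : IsOpen N) (φ : ↥N ≃ₜ Y) : C((𝕊 k) × (𝕊 k), OnePoint Y) :=
  OnePoint.collapseCM hNo φ

/-- The embedding `N → Y⁺`, `q ↦ φ q`. [folklore] -/
def thomIncl (φ : ↥N ≃ₜ Y) : C(↥N, OnePoint Y) :=
  ⟨fun q => ((φ q : Y) : OnePoint Y), OnePoint.continuous_coe.comp φ.continuous⟩

/-- On `N` the collapse is the embedding `N → Y⁺`. [folklore] -/
theorem thomCollapse_comp_subsetIncl :
    (thomCollapse hNo φ).comp (subsetIncl N) = thomIncl φ := by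
  ext x : 1
  exact OnePoint.collapse_apply_coe N _ x

/-- The image of the diagonal in the Thom space. [folklore] -/
def thomDiag (φ : ↥N ≃ₜ Y) : Set (OnePoint Y) :=
  (thomIncl φ) '' {q : ↥N | (q : (𝕊 k) × (𝕊 k)) ∈ diagonal k}

/-- The image of the diagonal is compact (it is a continuous image of `Sᵏ`). [folklore] -/
theorem isCompact_thomDiag (hΔ : diagonal k ⊆ N) : IsCompact (thomDiag φ) := by
  have : thomDiag φ = Set.range (fun x : 𝕊 k => thomIncl φ ⟨(x, x), hΔ rfl⟩) := by
    ext z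
    simp only [thomDiag, Set.mem_image, Set.mem_setOf_eq, Set.mem_range]
    constructor
    · rintro ⟨q, hq, rfl⟩
      refine ⟨q.1.1, ?_⟩
      congr 1
      apply Subtype.ext
      exact Prod.ext rfl hq
    · rintro ⟨x, rfl⟩
      exact ⟨⟨(x, x), hΔ rfl⟩, rfl, rfl⟩
  rw [this]
  exact isCompact_range ((thomIncl φ).continuous.comp
    ((continuous_id.prodMk continuous_id).subtype_mk _))

include hNo in
/-- The complement of the image of the diagonal is open (`Y⁺` is Hausdorff). [folklore] -/
theorem isOpen_compl_thomDiag (hΔ : diagonal k ⊆ N) : IsOpen (thomDiag φ)ᶜ := by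
  haveI : LocallyCompactSpace ↥N := hNo.locallyCompactSpace
  haveI : T2Space Y := φ.symm.isEmbedding.t2Space
  haveI : LocallyCompactSpace Y := φ.symm.isOpenEmbedding.locallyCompactSpace
  exact (isCompact_thomDiag φ hΔ).isClosed.isOpen_compl

/-- Off the diagonal, the collapse lands in the complement of the image of the diagonal. [folklore] -/
theorem thomCollapse_mem_compl_thomDiag {q : (𝕊 k) × (𝕊 k)} (hq : q ∉ diagonal k) :
    thomCollapse hNo φ q ∈ (thomDiag φ)ᶜ := by
  intro h
  obtain ⟨q', hq', he⟩ := h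
  by_cases hqN : q ∈ N
  · have e : thomCollapse hNo φ q = (((φ ⟨q, hqN⟩ : Y)) : OnePoint Y) :=
      OnePoint.collapse_apply_of_mem N _ hqN
    rw [e] at he
    have e2 : q' = ⟨q, hqN⟩ := φ.injective (OnePoint.coe_injective he)
    have e3 : (q' : (𝕊 k) × (𝕊 k)) = q := congrArg Subtype.val e2
    exact hq (e3 ▸ hq')
  · have e : thomCollapse hNo φ q = OnePoint.infty := OnePoint.collapse_apply_of_not_mem N _ hqN
    rw [e] at he
    exact OnePoint.coe_ne_infty _ he

include hNo in
/-- **The Thom class of a tube of the diagonal.** For `k ≥ 2` even and an open neighbourhood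
`N ≅ Y` of the diagonal of `Sᵏ × Sᵏ` there is `ξ ∈ Hᵏ(Y⁺; ℤ)` which restricts along `N → Y⁺` to
(the restriction of) `g₁ + g₂` and vanishes on the complement of the image of the diagonal: glue
(Mayer–Vietoris, Hatcher §3.1 pp. 203–204) the class `(g₁ + g₂)|_N` on `Y⁺ ∖ ∞ ≅ N` with `0` on
`Y⁺ ∖ Δ`, compatibly since `(g₁ + g₂)|_{N ∖ Δ} = 0` (`map_compl_diagonal_g_add_g`). This is the
Thom class of the normal bundle of the diagonal (Milnor–Stasheff §11, Thm. 11.1: the dual class of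
`Δ` restricts to the Thom class), constructed without bundles. [cite: MilnorStasheff1974, §11 Thm. 11.1 and §18 p. 205] [cite: HatcherAT2002, §3.1 pp. 203–204] -/
theorem exists_thomClass (hk : 2 ≤ k) (hke : Even k) (hΔ : diagonal k ⊆ N) :
    ∃ ξ : ↥(singularCohomology ℤ ℤ (OnePoint Y) k),
      singularCohomology.map ℤ ℤ (thomIncl φ) k ξ =
        singularCohomology.map ℤ ℤ (subsetIncl N) k (g hk 0 + g hk 1) ∧
      singularCohomology.map ℤ ℤ (subsetIncl (thomDiag φ)ᶜ) k ξ = 0 := by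
  -- the cover `Y⁺ = A ∪ B`, `A = Y⁺ ∖ ∞`, `B = Y⁺ ∖ Δ`
  set A : Set (OnePoint Y) := Set.range ((↑) : Y → OnePoint Y) with hA
  set B : Set (OnePoint Y) := (thomDiag φ)ᶜ with hB
  have hAo : IsOpen A := OnePoint.isOpen_range_coe
  have hBo : IsOpen B := isOpen_compl_thomDiag hNo φ hΔ
  have hAB : A ∪ B = Set.univ := by
    refine Set.eq_univ_of_forall fun z => ?_
    induction z using OnePoint.rec with
    | infty => exact Or.inr fun ⟨q, _, h⟩ => OnePoint.coe_ne_infty _ h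
    | coe q => exact Or.inl ⟨q, rfl⟩
  -- `N ≅ Y ≅ A`
  let eY : Y ≃ₜ ↥A := OnePoint.isOpenEmbedding_coe.toIsEmbedding.toHomeomorph
  let eA : ↥N ≃ₜ ↥A := φ.trans eY
  have heA : (subsetIncl A).comp (eA : C(↥N, ↥A)) = thomIncl φ := by
    ext q : 1; rfl
  -- the class on `A`: `(g₁ + g₂)|_N` transported along `eA`
  set t : ↥(singularCohomology ℤ ℤ ((𝕊 k) × (𝕊 k)) k) := g hk 0 + g hk 1 with ht
  set a : ↥(singularCohomology ℤ ℤ ↥A k) :=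
    singularCohomology.map ℤ ℤ (eA.symm : C(↥A, ↥N)) k (singularCohomology.map ℤ ℤ (subsetIncl N) k t) with ha
  -- compatibility on `A ∩ B`: both restrictions vanish, since `A ∩ B` maps into `X ∖ Δ`
  have hmaps : ∀ z : ↥(A ∩ B), ((eA.symm ⟨z.1, z.2.1⟩ : ↥N) : (𝕊 k) × (𝕊 k)) ∈ (diagonal k)ᶜ := by
    intro z hz
    apply z.2.2
    refine ⟨eA.symm ⟨z.1, z.2.1⟩, hz, ?_⟩
    have e1 : thomIncl φ (eA.symm ⟨z.1, z.2.1⟩) = ((subsetIncl A).comp (eA : C(↥N, ↥A))) (eA.symm ⟨z.1, z.2.1⟩) := by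
      rw [heA]
    rw [e1, ContinuousMap.comp_apply]
    change ((eA (eA.symm ⟨z.1, z.2.1⟩) : ↥A) : OnePoint Y) = z.1
    rw [eA.apply_symm_apply]
  let f : C(↥(A ∩ B), ↥((diagonal k)ᶜ)) :=
    ⟨fun z => ⟨((eA.symm ⟨z.1, z.2.1⟩ : ↥N) : (𝕊 k) × (𝕊 k)), hmaps z⟩, by fun_prop⟩
  have hfac : (subsetIncl N).comp ((eA.symm : C(↥A, ↥N)).comp
      (ContinuousMap.inclusion (Set.inter_subset_left : A ∩ B ⊆ A))) =
      (subsetIncl ((diagonal k)ᶜ)).comp f := by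
    ext z : 1; rfl
  have hcompat : singularCohomology.map ℤ ℤ (ContinuousMap.inclusion (Set.inter_subset_left : A ∩ B ⊆ A)) k a =
      singularCohomology.map ℤ ℤ (ContinuousMap.inclusion (Set.inter_subset_right : A ∩ B ⊆ B)) k 0 := by
    rw [map_zero, ha, ← ModuleCat.comp_apply, ← ModuleCat.comp_apply, ← singularCohomology.map_comp,
      ← singularCohomology.map_comp, hfac, singularCohomology.map_comp, ModuleCat.comp_apply, ht,
      map_compl_diagonal_g_add_g hk hke, map_zero]
  obtain ⟨ξ, hξA, hξB⟩ := singularCohomology.exists_of_map_inclusion_eq ℤ hAo hBo hAB a 0 hcompat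
  refine ⟨ξ, ?_, hξB⟩
  rw [← heA, singularCohomology.map_comp, ModuleCat.comp_apply, hξA, ha, ← ModuleCat.comp_apply,
    ← singularCohomology.map_comp]
  have : ((eA.symm : C(↥A, ↥N)).comp (eA : C(↥N, ↥A))) = ContinuousMap.id _ := by
    ext q : 1; exact eA.symm_apply_apply q
  rw [this, singularCohomology.map_id, ModuleCat.id_apply]

include hNo in
/-- **The collapse pulls the Thom class back to the dual class of the diagonal: `c^* ξ = g₁ + g₂`**
(`k ≥ 2` even). The difference vanishes on `N` (there `c` is the embedding `N → Y⁺`) and off the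
diagonal (there `c` lands in `Y⁺ ∖ Δ`, where `ξ = 0`, while `g₁ + g₂` vanishes off the diagonal),
hence is zero (`eq_zero_of_map_nhd_diagonal_eq_zero`). Milnor–Stasheff Thm. 11.1 / §18: the
dual class of a submanifold is the image of the Thom class under the collapse. [cite: MilnorStasheff1974, §11 Thm. 11.1 and §18 p. 205] -/
theorem map_thomCollapse_thomClass (hk : 2 ≤ k) (hke : Even k) (hΔ : diagonal k ⊆ N)
    {ξ : ↥(singularCohomology ℤ ℤ (OnePoint Y) k)}
    (hξA : singularCohomology.map ℤ ℤ (thomIncl φ) k ξ =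
      singularCohomology.map ℤ ℤ (subsetIncl N) k (g hk 0 + g hk 1))
    (hξB : singularCohomology.map ℤ ℤ (subsetIncl (thomDiag φ)ᶜ) k ξ = 0) :
    singularCohomology.map ℤ ℤ (thomCollapse hNo φ) k ξ = g hk 0 + g hk 1 := by
  rw [← sub_eq_zero]
  apply eq_zero_of_map_nhd_diagonal_eq_zero hk hke hΔ
  · rw [map_sub, sub_eq_zero, ← ModuleCat.comp_apply, ← singularCohomology.map_comp,
      thomCollapse_comp_subsetIncl, hξA]
  · -- off the diagonal the collapse factors through `B = Y⁺ ∖ Δ`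
    let cB : C(↥((diagonal k)ᶜ), ↥((thomDiag φ)ᶜ)) :=
      ⟨fun q => ⟨thomCollapse hNo φ q.1, thomCollapse_mem_compl_thomDiag hNo φ q.2⟩, by fun_prop⟩
    have hfac : (thomCollapse hNo φ).comp (subsetIncl ((diagonal k)ᶜ)) =
        (subsetIncl ((thomDiag φ)ᶜ)).comp cB := by
      ext q : 1; rfl
    rw [map_sub, ← ModuleCat.comp_apply, ← singularCohomology.map_comp, hfac,
      singularCohomology.map_comp, ModuleCat.comp_apply, hξB, map_zero, zero_sub, neg_eq_zero]
    exact map_compl_diagonal_g_add_g hk hke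

/-- **The square of the Thom class evaluates to `±2` on the collapsed fundamental class of
`Sᵏ × Sᵏ`**: `⟨ξ ⌣ ξ, c₊[X]⟩ = ⟨c^*ξ ⌣ c^*ξ, [X]⟩ = ⟨(g₁ + g₂)², [X]⟩ = ±2` (`k ≥ 2` even;
Milnor–Stasheff Cor. 11.2: `Δ · Δ = χ(Sᵏ) = 2`). [cite: MilnorStasheff1974, §11 Cor. 11.2 and §18] -/
theorem abs_kroneckerPairing_thomClass_sq (hk : 2 ≤ k) (hke : Even k) (hΔ : diagonal k ⊆ N)
    {D : ℕ} (hD : k + k = D) (μ : HomologicalOrientation ℤ ((𝕊 k) × (𝕊 k)) D)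
    {ξ : ↥(singularCohomology ℤ ℤ (OnePoint Y) k)}
    (hξA : singularCohomology.map ℤ ℤ (thomIncl φ) k ξ =
      singularCohomology.map ℤ ℤ (subsetIncl N) k (g hk 0 + g hk 1))
    (hξB : singularCohomology.map ℤ ℤ (subsetIncl (thomDiag φ)ᶜ) k ξ = 0) :
    |kroneckerPairing ℤ ℤ (OnePoint Y) D (cupProduct hD ξ ξ)
      (singularHomology.map ℤ ℤ (thomCollapse hNo φ) D μ.fundamentalClass)| = 2 := by
  rw [← kroneckerPairing_map, cupProduct_map, map_thomCollapse_thomClass hNo φ hk hke hΔ hξA hξB,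
    ← cupPairing_apply]
  exact abs_cupPairing_g_add_g hk hke hD μ

end ThomCollapse

end SphereProd

end Literature.Topology.FourManifolds

end
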